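import Literature.NumberTheory.LocalFields.RamifiedQuadraticOrderLattices     -- ★ (F3c-i′) B-p04: Mars for any involution, ramified orders
import HarnessLib

/-!
# `GL₂(F) = ⊔_{i ≥ 0} ι′(L^×) · diag(1, π^i) · GL₂(𝒪_F)` for a RAMIFIED quadratic `L ∕ F` — Mars' lattice lemma in matrix dress (σ-form)
(Flicker, *Elementary proof of the fundamental lemma for a unitary group* (1998), Prop. 6 second half p. 83 «`GL(2, F) = ⋃_j T₁ r_j K`, `T₁ ∋ u + v w`, `w² = π`»;
REMARK p. 84)

Topic `NumberTheory/LocalFields`; namespace `Literature.NumberTheory.LocalFields.RamifiedQuadraticOrder` (= ★ (F3b) ∕ ★ (F3c-i′)).  THEOREMS ONLY (no `def`, no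
instance, no notation, no named fact, no `sorry`).  Cell `pub/hodgecm-mathlib`, F0∕P3a road «N7-ns COUNT FROM FLICKER» (MAP v3, architect A-p06 (g26)), brick
**(F3c-γ′) FILE γ1′** (B-p04 (g33), 05:56Z; A-p03 (g24) 05:55:02Z «(F3c-γ′) = ONE new brick: the type-(2) Prop. 6»): the RAMIFIED clone of B-p12 (g28)'s ★ γ1
`UnramifiedQuadraticLatticeDoubleCosets.exists_coords_eq_iota_diag_pow` (p841089), with Mars for ANY involution (★ p841571) in place of the unramified Mars and the
basis `(1, ϖ)` of `S = R_L` over `S^σ = 𝒪_F` in place of `(1, a)`.  The `U(Φ₃)`-side transport γ2′ (`T_H = Z_H(t)` for `t` of type (2), Flicker's `r_j = t_j·diag(1,(−π)^j)`)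
rewrites these entry identities, as γ2 did with γ1.  HC_CM is proved only modulo the printed citations until rung 0 closes; pays nothing by itself.

FRAME (★ (F3b)): `S` a DVR, `σ` with `hσ : σσ = id`, `hres : ∀ x, σ x − x ∈ 𝔪` (residually trivial = ramified), `hϖ : Irreducible ϖ`, `hσϖ : σ ϖ = −ϖ`, `h2 : IsUnit 2`.
* §0 `mul_coords_ramified` — `(u + vϖ)(x + yϖ) = (ux + ϖ² v y) + (vx + uy)ϖ` (so `ι′(u + vϖ) = (u, πv; v, u)`, `π = ϖ²`).
* §1 `coords_indep_ramified` — the columns `c_k = g₀ₖ + g₁ₖϖ` of a `σ`-fixed `g` with `det g ≠ 0` are `S^σ`-independent.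
* §2 `exists_coords_of_map_sub_self_mem_pow_odd` (`σy − y ∈ 𝔪^{2i+1} ⇒ y = U + ϖ^{2i} W ϖ`, `U, W` fixed) and the head
  **`exists_coords_eq_iota_diag_pow_ramified (g) (hg : σ-fixed) (hdet) : ∃ u v i U₀ U₁ W₀ W₁, … ∧ u + vϖ ≠ 0 ∧ IsUnit (U₀W₁ − U₁W₀) ∧
  g₀ₖ = u Uₖ + ϖ²·(v (ϖ^{2i} Wₖ)) ∧ g₁ₖ = v Uₖ + u (ϖ^{2i} Wₖ)`** (`k = 0, 1`) — `g = ι′(z)·diag(1, π^i)·k`, `k ∈ GL₂(𝒪_F)`.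
* §3 `forall_mul_mem_iff_map_sub_self_mem_pow_ramified` (multiplier order), **`eq_of_lattice_eq_ramified`** (the exponent `i` of `z·(S^σ + ϖ^{2i}S)` is unique ⇒
  disjointness of the double cosets, Prop. 6 (b)).

## References
* [Flicker1998UnitaryFL] Y. Z. Flicker, *Elementary proof of the fundamental lemma for a unitary group*, Canad. J. Math. 50 (1998), Prop. 6 p. 83; REMARK p. 84.
* [Serre1979] J.-P. Serre, *Local Fields*, GTM 67 (1979), Ch. IV §1 Prop. 3.
-/

namespace Literature.NumberTheory.LocalFields.RamifiedQuadraticOrder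

open IsLocalRing Literature.NumberTheory.LocalFields.UnramifiedQuadraticNorm

universe u

variable {S : Type u} [CommRing S] (σ : S →+* S)

/-! ## §0 Coordinates in the basis `(1, ϖ)` -/

/-- Multiplication by `z = u + v·ϖ` in the basis `(1, ϖ)`: `(u + vϖ)(x + yϖ) = (u x + ϖ²·v y) + (v x + u y)·ϖ`. [cite: Serre1979, Ch. IV §1 Prop. 3] -/
theorem mul_coords_ramified (ϖ u v x y : S) :
    (u + v * ϖ) * (x + y * ϖ) = (u * x + ϖ ^ 2 * (v * y)) + (v * x + u * y) * ϖ := by ring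

/-! ## §1 The lattice of a `σ`-fixed `2 × 2` matrix -/

section Indep

variable [IsDomain S] {ϖ : S} (hσϖ : σ ϖ = -ϖ) (h2 : (2 : S) ≠ 0) (hϖ0 : ϖ ≠ 0)

include hσϖ h2 hϖ0 in
/-- `S^σ`-independence of the columns `c_k = g₀ₖ + g₁ₖ ϖ` when `det g ≠ 0`: `p c₀ + q c₁ = 0` with `σ`-fixed `p, q` forces `p = q = 0`.
[cite: Flicker1998UnitaryFL, Prop. 6 p. 83] -/
theorem coords_indep_ramified {g : Matrix (Fin 2) (Fin 2) S} (hg : ∀ i j, σ (g i j) = g i j) (hdet : g 0 0 * g 1 1 - g 0 1 * g 1 0 ≠ 0)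
    {p q : S} (hp : σ p = p) (hq : σ q = q) (h : p * (g 0 0 + g 1 0 * ϖ) + q * (g 0 1 + g 1 1 * ϖ) = 0) : p = 0 ∧ q = 0 := by
  have h' : (p * g 0 0 + q * g 0 1) + (p * g 1 0 + q * g 1 1) * ϖ = 0 + 0 * ϖ := by linear_combination h
  obtain ⟨e1, e2⟩ := fixed_coords_unique σ hσϖ h2 hϖ0 (by rw [map_add, map_mul, map_mul, hp, hq, hg, hg])
    (by rw [map_add, map_mul, map_mul, hp, hq, hg, hg]) (map_zero σ) (map_zero σ) h'
  have hp0 : p * (g 0 0 * g 1 1 - g 0 1 * g 1 0) = 0 := by linear_combination g 1 1 * e1 - g 0 1 * e2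
  have hq0 : q * (g 0 0 * g 1 1 - g 0 1 * g 1 0) = 0 := by linear_combination -(g 1 0) * e1 + g 0 0 * e2
  exact ⟨(mul_eq_zero.1 hp0).resolve_right hdet, (mul_eq_zero.1 hq0).resolve_right hdet⟩

end Indep

/-! ## §2 `g = ι′(z) · diag(1, π^i) · k` -/

section Main

variable [IsDomain S] [IsDiscreteValuationRing S] (hσ : ∀ x, σ (σ x) = x) (hres : ∀ x, σ x - x ∈ maximalIdeal S)
  {ϖ : S} (hϖ : Irreducible ϖ) (hσϖ : σ ϖ = -ϖ) (h2 : IsUnit (2 : S))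

include hσ hres hϖ hσϖ h2 in
/-- `{y : σ y − y ∈ 𝔪^{2i+1}} = S^σ ⊕ ϖ^{2i} S^σ·ϖ` in coordinates: `σy − y ∈ 𝔪^{2i+1}` iff `y = U + ϖ^{2i}·W·ϖ` with `σ`-fixed `U, W`.
[cite: Flicker1998UnitaryFL, Prop. 6 p. 83] [cite: Serre1979, Ch. IV §1 Prop. 3] -/
theorem exists_coords_of_map_sub_self_mem_pow_odd {i : ℕ} {y : S} (hy : σ y - y ∈ maximalIdeal S ^ (2 * i + 1)) :
    ∃ U W : S, σ U = U ∧ σ W = W ∧ y = U + ϖ ^ (2 * i) * W * ϖ := by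
  obtain ⟨a, b, ha, hb, ⟨c, hc⟩, hy'⟩ := (map_sub_self_mem_pow_odd_iff σ hσ hres hϖ hσϖ h2 i y).1 hy
  have h1 : σ (ϖ ^ (2 * i)) = ϖ ^ (2 * i) := by rw [map_pow, hσϖ, neg_pow, pow_mul, neg_one_sq, one_pow, one_mul]
  have hcσ : σ c = c := by
    have h3 : ϖ ^ (2 * i) * σ c = ϖ ^ (2 * i) * c := by
      have := hb; rw [hc, map_mul, h1] at this; exact this
    exact mul_left_cancel₀ (pow_ne_zero _ hϖ.ne_zero) h3
  exact ⟨a, c, ha, hcσ, by rw [hy', hc]⟩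

include hσ hres hϖ hσϖ h2 in
/-- **`GL₂(F) = ⊔_i ι′(L^×) diag(1, π^i) GL₂(𝒪_F)` for RAMIFIED `L ∕ F` (existence, in coordinates)** — Flicker Prop. 6, second half, p. 83 «`GL(2,F) = ⋃_j T₁ r_j K`,
`T₁ ∋ u + v w`, `w² = π`»: for a `σ`-FIXED `g ∈ M₂(S)` with `det g ≠ 0` (`S = R_L`, `S^σ = 𝒪_F`) there are `σ`-fixed `u v` (`z = u + vϖ ≠ 0`), `i ≥ 0`, and
`σ`-fixed `U₀ U₁ W₀ W₁` with `U₀W₁ − U₁W₀` a UNIT such that, entrywise, **`g = ι′(z) · diag(1, π^i) · k`**, `ι′(u + vϖ) = (u, πv; v, u)`, `π = ϖ²`: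
`g₀ₖ = u·Uₖ + ϖ²·v·(ϖ^{2i} Wₖ)`, `g₁ₖ = v·Uₖ + u·(ϖ^{2i} Wₖ)`; the column lattice is `Λ_g = z·(S^σ + ϖ^{2i}S) `: `g₀ₖ + g₁ₖϖ = z(Uₖ + ϖ^{2i}Wₖϖ)`.  Proof = ★ γ1
(B-p12, unramified) with MARS for any involution (★ `exists_forall_mem_iff_exists_map_sub_self_mem_pow_and_eq_mul`) and the odd normalisation.
[cite: Flicker1998UnitaryFL, Prop. 6 p. 83; REMARK p. 84] -/
theorem exists_coords_eq_iota_diag_pow_ramified (g : Matrix (Fin 2) (Fin 2) S) (hg : ∀ i j, σ (g i j) = g i j)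
    (hdet : g 0 0 * g 1 1 - g 0 1 * g 1 0 ≠ 0) :
    ∃ (u v : S) (i : ℕ) (U₀ U₁ W₀ W₁ : S), σ u = u ∧ σ v = v ∧ u + v * ϖ ≠ 0 ∧ σ U₀ = U₀ ∧ σ U₁ = U₁ ∧ σ W₀ = W₀ ∧ σ W₁ = W₁ ∧
      IsUnit (U₀ * W₁ - U₁ * W₀) ∧
      g 0 0 = u * U₀ + ϖ ^ 2 * (v * (ϖ ^ (2 * i) * W₀)) ∧ g 1 0 = v * U₀ + u * (ϖ ^ (2 * i) * W₀) ∧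
      g 0 1 = u * U₁ + ϖ ^ 2 * (v * (ϖ ^ (2 * i) * W₁)) ∧ g 1 1 = v * U₁ + u * (ϖ ^ (2 * i) * W₁) := by
  classical
  have h20 : (2 : S) ≠ 0 := h2.ne_zero
  set c₀ : S := g 0 0 + g 1 0 * ϖ with hc₀
  set c₁ : S := g 0 1 + g 1 1 * ϖ with hc₁
  let Λ : AddSubgroup S :=
    { carrier := {x | ∃ p q : S, σ p = p ∧ σ q = q ∧ x = p * c₀ + q * c₁}
      zero_mem' := ⟨0, 0, map_zero σ, map_zero σ, by ring⟩
      add_mem' := by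
        rintro _ _ ⟨p, q, hp, hq, rfl⟩ ⟨p', q', hp', hq', rfl⟩
        exact ⟨p + p', q + q', by rw [map_add, hp, hp'], by rw [map_add, hq, hq'], by ring⟩
      neg_mem' := by
        rintro _ ⟨p, q, hp, hq, rfl⟩
        exact ⟨-p, -q, by rw [map_neg, hp], by rw [map_neg, hq], by ring⟩ }
  have hΛ : ∀ x, x ∈ Λ ↔ ∃ p q : S, σ p = p ∧ σ q = q ∧ x = p * c₀ + q * c₁ := fun _ => Iff.rfl
  have hc₀Λ : c₀ ∈ Λ := ⟨1, 0, map_one σ, map_zero σ, by ring⟩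
  have hc₁Λ : c₁ ∈ Λ := ⟨0, 1, map_zero σ, map_one σ, by ring⟩
  have hmul : ∀ r x, σ r = r → x ∈ Λ → r * x ∈ Λ := by
    rintro r _ hr ⟨p, q, hp, hq, rfl⟩
    exact ⟨r * p, r * q, by rw [map_mul, hr, hp], by rw [map_mul, hr, hq], by ring⟩
  have hind : ∀ p q : S, σ p = p → σ q = q → p * c₀ + q * c₁ = 0 → p = 0 ∧ q = 0 :=
    fun p q hp hq h => coords_indep_ramified σ hσϖ h20 hϖ.ne_zero hg hdet hp hq h
  have hne : ∃ x ∈ Λ, x ≠ 0 := by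
    refine ⟨c₀, hc₀Λ, fun h0 => ?_⟩
    have := hind 1 0 (map_one σ) (map_zero σ) (by rw [h0]; ring)
    exact one_ne_zero this.1
  have hrk : ¬ ∃ z : S, ∀ x ∈ Λ, ∃ r, σ r = r ∧ x = z * r := by
    rintro ⟨z, hz⟩
    obtain ⟨r₀, hr₀, h₀⟩ := hz c₀ hc₀Λ
    obtain ⟨r₁, hr₁, h₁⟩ := hz c₁ hc₁Λ
    have hrel : r₁ * c₀ + (-r₀) * c₁ = 0 := by rw [h₀, h₁]; ring
    obtain ⟨e₁, e₀⟩ := hind r₁ (-r₀) hr₁ (by rw [map_neg, hr₀]) hrel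
    have hc0 : c₀ = 0 := by rw [h₀, neg_eq_zero.1 e₀, mul_zero]
    exact one_ne_zero (hind 1 0 (map_one σ) (map_zero σ) (by rw [hc0]; ring)).1
  -- MARS (any involution) and the odd normalisation of the exponent
  obtain ⟨z, j, hzΛ, hz0, hΛz⟩ := exists_forall_mem_iff_exists_map_sub_self_mem_pow_and_eq_mul σ hσ h2 Λ hmul hne hrk
  obtain ⟨i, hi⟩ := exists_forall_mem_pow_iff_mem_pow_odd σ hσ hres hϖ hσϖ h2 j
  have hΛz' : ∀ x, x ∈ Λ ↔ ∃ w, σ w - w ∈ maximalIdeal S ^ (2 * i + 1) ∧ x = z * w := fun x => by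
    rw [hΛz]; exact exists_congr fun w => by rw [hi]
  -- the columns in the basis `(z, z ϖ^{2i} ϖ)`
  obtain ⟨y₀, hy₀, hcy₀⟩ := (hΛz' c₀).1 hc₀Λ
  obtain ⟨y₁, hy₁, hcy₁⟩ := (hΛz' c₁).1 hc₁Λ
  obtain ⟨U₀, W₀, hU₀, hW₀, hyUW₀⟩ := exists_coords_of_map_sub_self_mem_pow_odd σ hσ hres hϖ hσϖ h2 hy₀
  obtain ⟨U₁, W₁, hU₁, hW₁, hyUW₁⟩ := exists_coords_of_map_sub_self_mem_pow_odd σ hσ hres hϖ hσϖ h2 hy₁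
  -- coordinates of `z`
  obtain ⟨u, v, huσ, hvσ, hzuv⟩ := exists_fixed_add_fixed_mul σ hσ hres hϖ hσϖ h2 z
  have hσϖ2i : σ (ϖ ^ (2 * i)) = ϖ ^ (2 * i) := by rw [map_pow, hσϖ, neg_pow, pow_mul, neg_one_sq, one_pow, one_mul]
  have hσϖ2 : σ (ϖ ^ 2) = ϖ ^ 2 := by rw [map_pow, hσϖ, neg_sq]
  -- entry identities: `c_k = z y_k = (u + vϖ)(U_k + (ϖ^{2i} W_k) ϖ)`
  have hcol : ∀ (g0 g1 Uk Wk : S), σ g0 = g0 → σ g1 = g1 → σ Uk = Uk → σ Wk = Wk →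
      g0 + g1 * ϖ = z * (Uk + ϖ ^ (2 * i) * Wk * ϖ) →
      g0 = u * Uk + ϖ ^ 2 * (v * (ϖ ^ (2 * i) * Wk)) ∧ g1 = v * Uk + u * (ϖ ^ (2 * i) * Wk) := by
    intro g0 g1 Uk Wk h0 h1 hUk hWk hc
    have hc' : g0 + g1 * ϖ = (u * Uk + ϖ ^ 2 * (v * (ϖ ^ (2 * i) * Wk))) + (v * Uk + u * (ϖ ^ (2 * i) * Wk)) * ϖ := by
      rw [hc, hzuv, ← mul_coords_ramified ϖ u v Uk (ϖ ^ (2 * i) * Wk), mul_assoc]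
    refine fixed_coords_unique σ hσϖ h20 hϖ.ne_zero h0 h1 ?_ ?_ hc'
    · simp only [map_add, map_mul, hσϖ2, hσϖ2i, huσ, hUk, hvσ, hWk]
    · simp only [map_add, map_mul, hσϖ2i, huσ, hUk, hvσ, hWk]
  have hg0 := hg 0 0; have hg1 := hg 1 0; have hg2' := hg 0 1; have hg3 := hg 1 1
  obtain ⟨e00, e10⟩ := hcol (g 0 0) (g 1 0) U₀ W₀ hg0 hg1 hU₀ hW₀ (by rw [← hyUW₀, ← hcy₀])
  obtain ⟨e01, e11⟩ := hcol (g 0 1) (g 1 1) U₁ W₁ hg2' hg3 hU₁ hW₁ (by rw [← hyUW₁, ← hcy₁])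
  -- `k ∈ GL₂(S^σ)`: `z` and `z ϖ^{2i} ϖ` lie in `Λ = span(c₀, c₁)`
  have hzaΛ : z * (ϖ ^ (2 * i) * ϖ) ∈ Λ := by
    refine (hΛz' _).2 ⟨ϖ ^ (2 * i) * ϖ, ?_, rfl⟩
    have : σ (ϖ ^ (2 * i) * ϖ) - ϖ ^ (2 * i) * ϖ = -2 * ϖ ^ (2 * i + 1) := by rw [map_mul, hσϖ2i, hσϖ, pow_succ]; ring
    rw [this, Irreducible.maximalIdeal_eq hϖ, Ideal.span_singleton_pow]
    exact Ideal.mul_mem_left _ _ (Ideal.mem_span_singleton_self _)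
  obtain ⟨p₀, q₀, hp₀, hq₀, hzpq⟩ := (hΛ z).1 hzΛ
  obtain ⟨p₁, q₁, hp₁, hq₁, hzapq⟩ := (hΛ _).1 hzaΛ
  have hcz₀ : c₀ = U₀ * z + W₀ * (z * (ϖ ^ (2 * i) * ϖ)) := by rw [hcy₀, hyUW₀]; ring
  have hcz₁ : c₁ = U₁ * z + W₁ * (z * (ϖ ^ (2 * i) * ϖ)) := by rw [hcy₁, hyUW₁]; ring
  have hrel₀ : (U₀ * p₀ + W₀ * p₁ - 1) * c₀ + (U₀ * q₀ + W₀ * q₁) * c₁ = 0 := by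
    have := hcz₀; rw [hzapq, hzpq] at this; linear_combination -this
  have hrel₁ : (U₁ * p₀ + W₁ * p₁) * c₀ + (U₁ * q₀ + W₁ * q₁ - 1) * c₁ = 0 := by
    have := hcz₁; rw [hzapq, hzpq] at this; linear_combination -this
  obtain ⟨f₁, f₂⟩ := hind _ _ (by rw [map_sub, map_add, map_mul, map_mul, map_one, hU₀, hp₀, hW₀, hp₁])
    (by rw [map_add, map_mul, map_mul, hU₀, hq₀, hW₀, hq₁]) hrel₀
  obtain ⟨f₃, f₄⟩ := hind _ _ (by rw [map_add, map_mul, map_mul, hU₁, hp₀, hW₁, hp₁])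
    (by rw [map_sub, map_add, map_mul, map_mul, map_one, hU₁, hq₀, hW₁, hq₁]) hrel₁
  have hunit : IsUnit (U₀ * W₁ - U₁ * W₀) := by
    refine isUnit_iff_exists_inv.2 ⟨p₀ * q₁ - p₁ * q₀, ?_⟩
    linear_combination (U₁ * q₀ + W₁ * q₁) * f₁ + f₄ - (U₁ * p₀ + W₁ * p₁) * f₂
  have hz0' : u + v * ϖ ≠ 0 := by rw [← hzuv]; exact hz0
  exact ⟨u, v, i, U₀, U₁, W₀, W₁, huσ, hvσ, hz0', hU₀, hU₁, hW₀, hW₁, hunit, e00, e10, e01, e11⟩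

/-! ## §3 The multiplier order of `z·(S^σ + ϖ^{2i}S)` and uniqueness of the exponent -/

include hσ in
/-- The multiplier ring of `Λ = z·{w : σ w − w ∈ 𝔪^n}` is `{x : σ x − x ∈ 𝔪^n}` (`z ≠ 0`), for any `n`. [cite: Flicker1998UnitaryFL, REMARK p. 84] -/
theorem forall_mul_mem_iff_map_sub_self_mem_pow_ramified {z : S} (hz : z ≠ 0) (n : ℕ) (x : S) :
    (∀ y : S, (∃ w, σ w - w ∈ maximalIdeal S ^ n ∧ y = z * w) → ∃ w, σ w - w ∈ maximalIdeal S ^ n ∧ x * y = z * w) ↔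
      σ x - x ∈ maximalIdeal S ^ n := by
  constructor
  · intro h
    obtain ⟨w, hw, hxz⟩ := h z ⟨1, by rw [map_one, sub_self]; exact Ideal.zero_mem _, (mul_one z).symm⟩
    have hxw : x = w := mul_left_cancel₀ hz (by rw [← hxz, mul_comm])
    rwa [hxw]
  · rintro hx y ⟨w, hw, rfl⟩
    exact ⟨x * w, map_sub_self_mem_pow_mul σ hσ n hx hw, by ring⟩

include hσ hϖ hσϖ h2 in
/-- **UNIQUENESS OF THE EXPONENT (ramified)**: `z·(S^σ + ϖ^{2i}S) = z′·(S^σ + ϖ^{2i′}S)` forces `i = i′` — so the index `i` in `g = ι′(z)·diag(1,π^i)·k` depends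
only on the double coset `ι′(L^×)·g·GL₂(𝒪_F)` (Flicker's disjointness, Prop. 6 (b)). [cite: Flicker1998UnitaryFL, Prop. 6 p. 83; REMARK p. 84] -/
theorem eq_of_lattice_eq_ramified {z z' : S} (hz : z ≠ 0) {i i' : ℕ}
    (h : ∀ y : S, (∃ w, σ w - w ∈ maximalIdeal S ^ (2 * i + 1) ∧ y = z * w) ↔ ∃ w, σ w - w ∈ maximalIdeal S ^ (2 * i' + 1) ∧ y = z' * w) :
    i = i' := by
  have hz' : z' ≠ 0 := by
    rintro rfl
    obtain ⟨w, -, hw⟩ := (h z).1 ⟨1, by rw [map_one, sub_self]; exact Ideal.zero_mem _, (mul_one z).symm⟩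
    exact hz (by rw [hw, zero_mul])
  refine eq_of_forall_map_sub_self_mem_pow_odd_iff σ hϖ hσϖ h2 fun x => ?_
  rw [← forall_mul_mem_iff_map_sub_self_mem_pow_ramified σ hσ hz (2 * i + 1) x,
    ← forall_mul_mem_iff_map_sub_self_mem_pow_ramified σ hσ hz' (2 * i' + 1) x]
  constructor
  · intro hx y hy
    exact (h _).1 (hx y ((h y).2 hy))
  · intro hx y hy
    exact (h _).2 (hx y ((h y).1 hy))

end Main

end Literature.NumberTheory.LocalFields.RamifiedQuadraticOrder
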